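import Literature.NumberTheory.EllipticCurves.TateModuleRank
import Literature.AlgebraicGeometry.Motives.AbelianVarietyTorsionPointsCountProofs
import Literature.AlgebraicGeometry.Motives.AbelianVarietyFrobeniusCharpolyRigidity
import Literature.NumberTheory.DiophantineGeometry.AVGaloisModule
import HarnessLib

/-!
# `A[n](K̄) ≅ (ℤ/nℤ)^{2 dim A}` for `n` invertible in `K`: the `n`-torsion of an abelian variety over
# an arbitrary field is a free `ℤ/nℤ`-module of rank `2 dim A` (Mumford §6; Serre–Tate 1968, §1;
# Lang, *Abelian Varieties*, IV §3 Thm. 6 and VII §1 Prop. 1; Görtz–Wedhorn, *Algebraic Geometry II*, Prop. 27.188)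

## Sources

* D. Mumford, *Abelian Varieties* (Oxford 1970), §6, Application 3, Proposition (p. 64): for an
  abelian variety `X` of dimension `g` over an algebraically closed field and `n` not divisible by
  the characteristic, `X_n ≅ (ℤ/nℤ)^{2g}`.  [MumfordAV1970]
* J.-P. Serre, J. Tate, *Good reduction of abelian varieties*, Ann. of Math. 88 (1968), §1, p. 493:
  "it is known (cf. for instance [12, Ch. VII]) that `A_m` is a free `ℤ/mℤ`-module of rank
  `2 dim(A)`" (for `m` prime to the characteristic; [12] = Lang's book).  [SerreTate1968]
* S. Lang, *Abelian Varieties* (Interscience 1959 / Springer 1983), Ch. IV §3, Theorem 6 ("If `n` is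
  prime to the characteristic, then the kernel of `nδ` has exactly `n^{2r}` elements") and Ch. VII
  §1, Proposition 1 with its proof ("`g_1(A)` is a vector space over `ℤ/lℤ` of dimension `2r`";
  vectors of `T_l(A)` whose first components are an `𝔽_l`-basis of `g_1(A)` are a `ℤ_l`-basis of
  `T_l(A)`, by the inductive congruences `(1)`).  [Lang1983AbelianVarieties]
* U. Görtz, T. Wedhorn, *Algebraic Geometry II* (Springer 2023), Prop. 27.188 (p. 888): (1) for `n`
  invertible on `S`, `X[n] ≅ (ℤ/nℤ)^{2g}` étale-locally (over a separably closed field: on points),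
  proved from "`X[d]` has order `d^{2g}` for every `d ∣ n`" by the classification of finite abelian
  groups — the route taken here; (2) in characteristic `p`, `X[p^m](K) = (ℤ/p^mℤ)^{f(X)}` with
  `0 ≤ f(X) ≤ g` (the `p`-rank, Def. 27.189; referred to Mumford §15).  [GortzWedhorn2023]

## What the tree had, and what this file adds

The tree knows the ORDER of the torsion over any field — `AbelianVariety.natCard_geomTorsion`
(`#A[n](K̄) = |n|^{2 dim A}` for `(n : K) ≠ 0`, from the count axiom of the `AbelianVariety`
structure, discharged by `natCard_torsionPoints_of_isAlgClosed_holds`) — and the GROUP STRUCTURE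
only over `ℂ` (`nonempty_additive_torsionPoints_addEquiv_pi_zmod`, via the complex torus).  On the
other hand `Literature/NumberTheory/EllipticCurves/TateModuleRank.lean` already carries out Lang's
Ch. VII §1 argument for an arbitrary abelian group `G` and prime `p`: from the counts
`#G[pⁿ] = p^{dn}` it produces `P_1, …, P_d ∈ T_p G` (`exists_generators_of_card`) whose level-`n`
coordinate map `(ℤ/pⁿ)^d → G[pⁿ]` is bijective (`finLevelMap_bijective`).

This file assembles these into the structure theorem over an ARBITRARY base field:

* §1 (abelian groups, prime powers): the coordinate map is additive (`finLevelAddHom`), hence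
  `G[pⁿ] ≃+ (ℤ/pⁿℤ)^d` from the counts (`nonempty_torsionBy_addEquiv_pi_zmod_of_card`).
* §2 (abelian groups, primary decomposition): `G[ab] ≃+ G[a] × G[b]` for coprime `a, b`
  (`nonempty_torsionBy_mul_addEquiv_prod`, Bézout), and CRT on the coefficient side.
* §3 (abelian varieties): `#A[ℓᵐ](K̄) = ℓ^{2 dim A · m}` (`natCard_geomTorsion_prime_pow_eq`),
  `A[ℓⁿ](K̄) ≃+ (ℤ/ℓⁿ)^{2 dim A}` (`nonempty_geomTorsion_prime_pow_addEquiv_pi_zmod`), and the main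
  result **`nonempty_geomTorsion_addEquiv_pi_zmod`: `A[n](K̄) ≃+ (ℤ/nℤ)^{2 dim A}` for every `n` with
  `(n : K) ≠ 0`**, by induction over the prime factorisation (`Nat.recOnPosPrimePosCoprime`);
  corollary `exists_geomTorsion_addOrderOf_eq`: a geometric point of exact order `n` exists as soon
  as `dim A > 0`.
* §3 also records the `p`-primary structure for EVERY prime `p`, including `p = char K`:
  `exists_geomTorsion_prime_pow_addEquiv_pi_zmod` — `A[pⁿ](K̄) ≃+ (ℤ/pⁿ)^r` with one `r` for all `n`
  (from the tree's `exists_natCard_geomTorsion_prime_pow`); the bound `r ≤ dim A` for `p = char K`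
  (Görtz–Wedhorn 27.188 (2), Mumford §15) is not proved here.

No new named facts (`def … : Prop`) are introduced; everything is proved from the tree.  The
hypothesis `(n : K) ≠ 0` is exactly "`n` prime to the characteristic" (and excludes `n = 0`); for
`n` divisible by the characteristic the statement is false (the `p`-rank is at most `dim A`,
Mumford §6 p. 64), and nothing is claimed.

## References

* [MumfordAV1970] D. Mumford, *Abelian Varieties*, §6 Application 3, Proposition p. 64.
* [SerreTate1968] J.-P. Serre, J. Tate, *Good reduction of abelian varieties*, §1 p. 493.
* [Lang1983AbelianVarieties] S. Lang, *Abelian Varieties*, Ch. IV §3 Thm. 6; Ch. VII §1 Prop. 1.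
* [GortzWedhorn2023] U. Görtz, T. Wedhorn, *Algebraic Geometry II*, Prop. 27.188, Def. 27.189 (p. 888).
-/
noncomputable section

open scoped Classical

universe u

/-! ## §1  Abelian groups: from `#G[pⁿ] = p^{dn}` to `G[pⁿ] ≅ (ℤ/pⁿ)^d` (Lang VII §1, proof of Prop. 1) -/

namespace Literature.NumberTheory.EllipticCurves

namespace TateModule

variable {G : Type u} [AddCommGroup G] {p : ℕ} [Fact p.Prime] {d : ℕ}

/-- `(k mod m) • y = k • y` when `m • y = 0`. [folklore] -/
private theorem mod_nsmul_eq_nsmul {m k : ℕ} {y : G} (hy : m • y = 0) : (k % m) • y = k • y := by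
  conv_rhs => rw [← Nat.mod_add_div k m, add_nsmul, mul_comm m, mul_smul, hy, smul_zero, add_zero]

/-- The level-`n` coordinate map `(ℤ/pⁿ)^d → G[pⁿ]`, `c ↦ Σ cᵢ • (Pᵢ)_n` (the tree's `finLevelMap`),
is additive. [cite: Lang1983AbelianVarieties, Ch. VII §1 (proof of Prop. 1: the inductive congruences (1))] -/
def finLevelAddHom (P : Fin d → TateModule G p) (n : ℕ) :
    (Fin d → ZMod (p ^ n)) →+ AddSubgroup.torsionBy G ((p ^ n : ℕ) : ℤ) where
  toFun := finLevelMap P n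
  map_zero' := Subtype.ext (by simp [coe_finLevelMap])
  map_add' c c' := Subtype.ext (by
    haveI : NeZero (p ^ n) := ⟨pow_ne_zero n (Fact.out : p.Prime).ne_zero⟩
    simp only [coe_finLevelMap, AddSubgroup.coe_add, ← Finset.sum_add_distrib, ← add_nsmul]
    refine Finset.sum_congr rfl fun i _ => ?_
    rw [Pi.add_apply, ZMod.val_add, mod_nsmul_eq_nsmul (pow_smul_proj n (P i))])

/-- Unfolding of `finLevelAddHom`. [cite: Lang1983AbelianVarieties, Ch. VII §1 (proof of Prop. 1)] -/
@[simp] theorem finLevelAddHom_apply (P : Fin d → TateModule G p) (n : ℕ) (c : Fin d → ZMod (p ^ n)) :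
    finLevelAddHom P n c = finLevelMap P n c :=
  rfl

/-- **`G[pⁿ] ≅ (ℤ/pⁿℤ)^d` from the torsion counts `#G[pᵐ] = p^{dm}` (all `m`)** — Lang's inductive
argument (the first components of `P_1, …, P_d ∈ T_p G` form an `𝔽_p`-basis of `G[p]`, their `n`-th
components then generate `G[pⁿ]`, and the count forces independence): the tree's bijection
`finLevelMap_bijective`, as an isomorphism of groups.
[cite: Lang1983AbelianVarieties, Ch. VII §1 (Prop. 1 and its proof)] [cite: SerreTate1968, §1 (p. 493)] -/
theorem nonempty_torsionBy_addEquiv_pi_zmod_of_card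
    (hcard : ∀ n, Nat.card (AddSubgroup.torsionBy G ((p ^ n : ℕ) : ℤ)) = p ^ (d * n)) (n : ℕ) :
    Nonempty (AddSubgroup.torsionBy G ((p ^ n : ℕ) : ℤ) ≃+ (Fin d → ZMod (p ^ n))) := by
  obtain ⟨P, hP⟩ := exists_generators_of_card hcard
  exact ⟨(AddEquiv.ofBijective (finLevelAddHom P n) (finLevelMap_bijective hcard hP n)).symm⟩

end TateModule

end Literature.NumberTheory.EllipticCurves

/-! ## §2  Abelian groups: `G[ab] ≅ G[a] × G[b]` for coprime `a, b` (primary decomposition) -/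

namespace Literature.AlgebraicGeometry.Motives

section Coprime

variable {G : Type u} [AddCommGroup G]

/-- The sum map `G[a] × G[b] → G[ab]`, `(P, Q) ↦ P + Q`. [folklore] -/
private def torsionBySumHom (a b : ℕ) :
    AddSubgroup.torsionBy G (a : ℤ) × AddSubgroup.torsionBy G (b : ℤ) →+
      AddSubgroup.torsionBy G ((a * b : ℕ) : ℤ) where
  toFun PQ := ⟨(PQ.1 : G) + PQ.2, by
    have h1 : (a : ℤ) • (PQ.1 : G) = 0 := (Submodule.mem_torsionBy_iff _ _).1 PQ.1.2
    have h2 : (b : ℤ) • (PQ.2 : G) = 0 := (Submodule.mem_torsionBy_iff _ _).1 PQ.2.2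
    refine (Submodule.mem_torsionBy_iff _ _).2 ?_
    change (((a * b : ℕ) : ℤ)) • ((PQ.1 : G) + PQ.2) = 0
    rw [smul_add, Nat.cast_mul, mul_comm (a : ℤ), mul_smul, h1, smul_zero, zero_add,
      mul_comm (b : ℤ), mul_smul, h2, smul_zero]⟩
  map_zero' := Subtype.ext (by simp)
  map_add' PQ PQ' := Subtype.ext (by
    change ((PQ.1 : G) + PQ'.1) + ((PQ.2 : G) + PQ'.2) = ((PQ.1 : G) + PQ.2) + ((PQ'.1 : G) + PQ'.2)
    abel)

/-- **Primary decomposition of the torsion: `G[ab] ≅ G[a] × G[b]` for coprime `a, b`** (any abelian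
group; Bézout: `P = (ua)P + (vb)P`, `G[a] ∩ G[b] = 0`).
[cite: SerreTate1968, §1 (p. 493: "`A_m` is a free `ℤ/mℤ`-module")] [cite: MumfordAV1970, §6 Application 3 (Proposition p. 64)] -/
theorem nonempty_torsionBy_mul_addEquiv_prod {a b : ℕ} (hab : a.Coprime b) :
    Nonempty (AddSubgroup.torsionBy G ((a * b : ℕ) : ℤ) ≃+
      AddSubgroup.torsionBy G (a : ℤ) × AddSubgroup.torsionBy G (b : ℤ)) := by
  obtain ⟨u, v, huv⟩ := Nat.Coprime.isCoprime hab
  refine ⟨(AddEquiv.ofBijective (torsionBySumHom (G := G) a b) ⟨?_, ?_⟩).symm⟩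
  · -- injective: `P + Q = 0` with `P ∈ G[a]`, `Q ∈ G[b]` forces `P = Q = 0`
    rw [injective_iff_map_eq_zero]
    rintro ⟨P, Q⟩ h
    have hPQ : (P : G) + Q = 0 := congrArg Subtype.val h
    have hP : (a : ℤ) • (P : G) = 0 := (Submodule.mem_torsionBy_iff _ _).1 P.2
    have hQ : (b : ℤ) • (Q : G) = 0 := (Submodule.mem_torsionBy_iff _ _).1 Q.2
    have hP0 : (P : G) = 0 := by
      have e : (P : G) = (u * a + v * b) • (P : G) := by rw [huv, one_smul]
      rw [e, add_smul, mul_smul, hP, smul_zero, zero_add, mul_smul,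
        show (P : G) = -Q from eq_neg_of_add_eq_zero_left hPQ, smul_neg, hQ, neg_zero, smul_zero]
    have hQ0 : (Q : G) = 0 := by rwa [hP0, zero_add] at hPQ
    exact Prod.ext (Subtype.ext hP0) (Subtype.ext hQ0)
  · -- surjective: `x = (vb)x + (ua)x`
    rintro ⟨x, hx⟩
    have hx' : (((a * b : ℕ) : ℤ)) • x = 0 := (Submodule.mem_torsionBy_iff _ _).1 hx
    rw [Nat.cast_mul] at hx'
    refine ⟨(⟨(v * b) • x, (Submodule.mem_torsionBy_iff _ _).2 ?_⟩,
      ⟨(u * a) • x, (Submodule.mem_torsionBy_iff _ _).2 ?_⟩), Subtype.ext ?_⟩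
    · change (a : ℤ) • (v * b) • x = 0
      rw [smul_smul, show (a : ℤ) * (v * b) = v * (a * b) by ring, mul_smul, hx', smul_zero]
    · change (b : ℤ) • (u * a) • x = 0
      rw [smul_smul, show (b : ℤ) * (u * a) = u * (a * b) by ring, mul_smul, hx', smul_zero]
    · change (v * (b : ℤ)) • x + (u * (a : ℤ)) • x = x
      rw [← add_smul, add_comm, huv, one_smul]

/-- `(Fin d → M) × (Fin d → N) ≅ (Fin d → M × N)` (additive). [folklore] -/
private def piProdAddEquiv (d : ℕ) (M N : Type*) [AddCommGroup M] [AddCommGroup N] :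
    (Fin d → M) × (Fin d → N) ≃+ (Fin d → M × N) where
  toFun fg i := (fg.1 i, fg.2 i)
  invFun h := (fun i => (h i).1, fun i => (h i).2)
  left_inv _ := rfl
  right_inv _ := rfl
  map_add' _ _ := rfl

/-- **CRT on the coefficients: `(ℤ/a)^d × (ℤ/b)^d ≅ (ℤ/ab)^d` for coprime `a, b`**
(Mathlib `ZMod.chineseRemainder`). [folklore] -/
private def piZModProdAddEquiv (d : ℕ) {a b : ℕ} (hab : a.Coprime b) :
    (Fin d → ZMod a) × (Fin d → ZMod b) ≃+ (Fin d → ZMod (a * b)) :=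
  (piProdAddEquiv d (ZMod a) (ZMod b)).trans
    (AddEquiv.piCongrRight fun _ => (ZMod.chineseRemainder hab).toAddEquiv.symm)

end Coprime

/-! ## §3  Abelian varieties: `A[n](K̄) ≅ (ℤ/nℤ)^{2 dim A}` for `n` invertible in `K` -/

namespace AbelianVariety

open Literature.NumberTheory.EllipticCurves (TateModule)

variable {K : Type u} [Field K] (A : AbelianVariety K)

/-- `#A[ℓᵐ](K̄) = ℓ^{2 dim A · m}` for `ℓ` invertible in `K` (the tree's count `natCard_geomTorsion`,
Mumford §6 Prop. p. 64, fed with the theorem `natCard_torsionPoints_of_isAlgClosed_holds`; Lang IV §3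
Thm. 6). [cite: MumfordAV1970, §6 Application 3 (Proposition p. 64)]
[cite: Lang1983AbelianVarieties, Ch. IV §3 Thm. 6] -/
theorem natCard_geomTorsion_prime_pow_eq {ℓ : ℕ} (hℓ : (ℓ : K) ≠ 0) (m : ℕ) :
    Nat.card (A.geomTorsion ((ℓ ^ m : ℕ) : ℤ)) = ℓ ^ (2 * A.dim * m) := by
  rw [A.natCard_geomTorsion (natCard_torsionPoints_of_isAlgClosed_holds A (AlgebraicClosure K))
    ((ℓ ^ m : ℕ) : ℤ) (by rw [Int.cast_natCast, Nat.cast_pow]; exact pow_ne_zero m hℓ),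
    Int.natAbs_natCast, ← pow_mul, mul_comm]

/-- **`A[ℓⁿ](K̄) ≅ (ℤ/ℓⁿℤ)^{2 dim A}`** for a prime `ℓ` invertible in `K` (Lang VII §1 Prop. 1 from
the counts IV §3 Thm. 6; Mumford §6). [cite: MumfordAV1970, §6 Application 3 (Proposition p. 64)]
[cite: Lang1983AbelianVarieties, Ch. IV §3 Thm. 6 and Ch. VII §1 Prop. 1] -/
theorem nonempty_geomTorsion_prime_pow_addEquiv_pi_zmod {ℓ : ℕ} [Fact ℓ.Prime] (hℓ : (ℓ : K) ≠ 0)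
    (n : ℕ) : Nonempty (A.geomTorsion ((ℓ ^ n : ℕ) : ℤ) ≃+ (Fin (2 * A.dim) → ZMod (ℓ ^ n))) :=
  TateModule.nonempty_torsionBy_addEquiv_pi_zmod_of_card (G := A.geomPoints)
    (A.natCard_geomTorsion_prime_pow_eq hℓ) n

/-- **`A[pⁿ](K̄) ≅ (ℤ/pⁿℤ)^r` for EVERY prime `p` (also `p = char K`), with one `r = r(A, p)` for all
`n`**: Lang's argument (§1) applied to the tree's counts `#A[pⁿ](K̄) = p^{rn}`
(`exists_natCard_geomTorsion_prime_pow`, from the divisibility of `A(K̄)`).  For `p` invertible in `K`,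
`r = 2 dim A` (`nonempty_geomTorsion_prime_pow_addEquiv_pi_zmod`); for `p = char K` this `r` is the
`p`-rank `f(A)` of Görtz–Wedhorn, Def. 27.189 — the bound `f(A) ≤ dim A` of Prop. 27.188 (2)
(Mumford §15) is NOT proved here.
[cite: GortzWedhorn2023, Prop. 27.188 (2) and Def./Rem. 27.189 (p. 888)] [cite: MumfordAV1970, §15 (p. 147, the `p`-rank)] -/
theorem exists_geomTorsion_prime_pow_addEquiv_pi_zmod (p : ℕ) [Fact p.Prime] :
    ∃ r : ℕ, ∀ n : ℕ, Nonempty (A.geomTorsion ((p ^ n : ℕ) : ℤ) ≃+ (Fin r → ZMod (p ^ n))) := by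
  obtain ⟨r, hr⟩ := A.exists_natCard_geomTorsion_prime_pow p
  exact ⟨r, fun n => TateModule.nonempty_torsionBy_addEquiv_pi_zmod_of_card (G := A.geomPoints) hr n⟩

/-- `A[1](K̄) = 0`. [folklore] -/
private theorem geomTorsion_one_eq_zero (P : A.geomTorsion ((1 : ℕ) : ℤ)) : P = 0 := by
  have h := (mem_geomTorsion_iff' (P : A.geomPoints)).1 P.2
  rw [natCast_zsmul, one_smul] at h
  exact Subtype.ext h

/-- **Mumford §6 / Serre–Tate §1: `A[n](K̄) ≅ (ℤ/nℤ)^{2 dim A}` for every `n` invertible in `K`** —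
"`A_m` is a free `ℤ/mℤ`-module of rank `2 dim(A)`" (Serre–Tate, citing Lang), "`X_n ≅ (ℤ/nℤ)^{2g}`
if `p ∤ n`" (Mumford): the `n`-torsion of the geometric points of an abelian variety over an
ARBITRARY field `K`, for `n` prime to the characteristic.  Proof: prime powers from the torsion
counts by Lang's argument (§1), assembled over the primary decomposition `A[ab] ≅ A[a] × A[b]`,
`(ℤ/a)^{2g} × (ℤ/b)^{2g} ≅ (ℤ/ab)^{2g}` (coprime `a, b`; §2) — the route of Görtz–Wedhorn's proof of
Prop. 27.188 (1) ("for every divisor `d` of `n`, the `d`-torsion `G[d]` … is of order `d^{2g}` …; by the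
classification of finite abelian groups this implies `G ≅ (ℤ/nℤ)^{2g}`").
[cite: MumfordAV1970, §6 Application 3 (Proposition p. 64)] [cite: SerreTate1968, §1 (p. 493: "`A_m` is a free `ℤ/mℤ`-module of rank `2 dim(A)`")]
[cite: Lang1983AbelianVarieties, Ch. IV §3 Thm. 6 and Ch. VII §1 Prop. 1] [cite: GortzWedhorn2023, Prop. 27.188 (1) and its proof (p. 888)] -/
theorem nonempty_geomTorsion_addEquiv_pi_zmod {n : ℕ} (hn : (n : K) ≠ 0) :
    Nonempty (A.geomTorsion (n : ℤ) ≃+ (Fin (2 * A.dim) → ZMod n)) := by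
  induction n using Nat.recOnPosPrimePosCoprime with
  | zero => exact absurd Nat.cast_zero hn
  | one =>
    haveI : Unique (A.geomTorsion ((1 : ℕ) : ℤ)) :=
      ⟨⟨0⟩, fun P => A.geomTorsion_one_eq_zero P⟩
    haveI : Unique (Fin (2 * A.dim) → ZMod 1) := Pi.unique
    exact ⟨AddEquiv.ofUnique⟩
  | prime_pow p m hp hm =>
    haveI := Fact.mk hp
    have hpK : (p : K) ≠ 0 := fun h0 => hn (by rw [Nat.cast_pow, h0, zero_pow hm.ne'])
    exact A.nonempty_geomTorsion_prime_pow_addEquiv_pi_zmod hpK m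
  | coprime a b ha hb hab iha ihb =>
    have haK : (a : K) ≠ 0 := fun h0 => hn (by rw [Nat.cast_mul, h0, zero_mul])
    have hbK : (b : K) ≠ 0 := fun h0 => hn (by rw [Nat.cast_mul, h0, mul_zero])
    obtain ⟨ea⟩ := iha haK
    obtain ⟨eb⟩ := ihb hbK
    obtain ⟨e⟩ := nonempty_torsionBy_mul_addEquiv_prod (G := A.geomPoints) hab
    exact ⟨e.trans ((AddEquiv.prodCongr ea eb).trans (piZModProdAddEquiv (2 * A.dim) hab))⟩

/-- Hence **`A[n](K̄)` is a free `ℤ/nℤ`-module of rank `2 dim A`** in the sense that it is isomorphic,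
as an abelian group, to `(ℤ/nℤ)^{2 dim A}`; in particular `#A[n](K̄) = n^{2 dim A}` (the tree's
`natCard_geomTorsion`) and, for `dim A > 0`, `A[n](K̄)` contains a point of exact order `n`.
[cite: SerreTate1968, §1 (p. 493)] [cite: MumfordAV1970, §6 Application 3 (Proposition p. 64)] -/
theorem exists_geomTorsion_addOrderOf_eq {n : ℕ} (hn : (n : K) ≠ 0) (hA : 0 < A.dim) :
    ∃ P : A.geomPoints, P ∈ A.geomTorsion (n : ℤ) ∧ addOrderOf P = n := by
  obtain ⟨e⟩ := A.nonempty_geomTorsion_addEquiv_pi_zmod hn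
  let i₀ : Fin (2 * A.dim) := ⟨0, by omega⟩
  refine ⟨(e.symm (Pi.single i₀ 1) : A.geomTorsion (n : ℤ)), (e.symm (Pi.single i₀ 1)).2, ?_⟩
  have hinj : Function.Injective (AddMonoidHom.single (fun _ : Fin (2 * A.dim) => ZMod n) i₀) :=
    fun a b h => Pi.single_injective (M := fun _ : Fin (2 * A.dim) => ZMod n) i₀
      (by simpa only [AddMonoidHom.single_apply] using h)
  rw [AddSubgroup.addOrderOf_coe (e.symm (Pi.single i₀ 1)), AddEquiv.addOrderOf_eq,
    show (Pi.single i₀ (1 : ZMod n) : Fin (2 * A.dim) → ZMod n) =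
      AddMonoidHom.single (fun _ : Fin (2 * A.dim) => ZMod n) i₀ 1 from rfl,
    addOrderOf_injective (AddMonoidHom.single (fun _ : Fin (2 * A.dim) => ZMod n) i₀) hinj,
    ZMod.addOrderOf_one]

end AbelianVariety

end Literature.AlgebraicGeometry.Motives

end
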